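import Summits.CriticalPhenomena.PercolationContinuityZ3.Theorems.Transplant.TransitiveSusceptibilityDerivativePointwise
import Summits.CriticalPhenomena.PercolationContinuityZ3.Theorems.Transplant.IntegratedRussoBall
import HarnessLib

/-!
# Hutchcroft's differential inequality for the susceptibility (Prop. 1.6) on a vertex-transitive graph of bounded degree, INTEGRATED form

Proof file (`--supports stmt-CriticalPhenomena-4575 --as helper`), lane `prim-bschramm`, seat `prim-bschramm-gen-1` gen 13 (GEN pen); item (b3), second file, of the
Q-DOOR-2 port table (NOTES-g12-mirror §HANDOFF-QDOOR2; lead g29 #10068, R-584-1): the generic twin of the ℤ^d file «TriangleSusceptibilityDerivative» §Integration +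
`Hutchcroft2022_prop16_zd_holds`, from the pointwise bound «TransitiveSusceptibilityDerivativePointwise» `pivotalSum_ge` and (a) «IntegratedRussoBall»
`integral_sum_real_pivotal_le_conn_sub` (Russo, integrated, infinite volume) — **`prop16_transitive`**: on a connected vertex-transitive graph with degrees `≤ D`
(`D ≥ 1`), for `0 < p ≤ q < p_c(ρ)`, `∇_q(ρ) ≤ Δ ≤ χ_p` and `2A₀_q(ρ) + B₀_q(ρ) ≤ M`, `(q − p)(χ_p − Δ)² ≤ D q² M (χ_q − χ_p)`, `χ_s = Σ'_x τ_s(ρ,x)`.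
builds on p205010 (kernel theorem, internal audit signed; external expert review pending) — nothing here uses p205010.  Def-free; no instance, no notation, no
sorry; nothing about `θ(p_c)`.

PORT DICTIONARY: `pivProb d (openConn 0 x) e s` ↦ `P_{prm s}(e pivotal for openConn ρ x)`; the ℤ^d set identity `openConn 0 x = ⋃_n boxConn` ↦
`openConn_eq_iUnion_openConnIn_ball (hconn)` (a finite open path meets finitely many vertices, each in some graph ball of a CONNECTED graph), which identifies (a)'s
integrand (pivotality for `⋃_n {ρ ↔ x in B(ρ,n)}`) with «ClusterBoundary» `pivotalSum`'s (pivotality for `{ρ ↔ x}`) by `rw` — no a.e. argument needed.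
* §1 `openConn_eq_iUnion_openConnIn_ball`, **`lintegral_pivotalSum_le`** (`∫_{[p,q]} pivotalSum ds ≤ χ_q − χ_p`);
* §2 **`prop16_transitive`**.
[cite: Hutchcroft2022Triangle, Prop. 1.6 and §2 ((2.1))] [cite: GrimmettPercolation1999, §2.4 Thm. 2.25, §10.3 (10.62)]
-/

noncomputable section

namespace Summit.CriticalPhenomena.PercolationContinuityZ3.Theorems.Transplant

namespace Grigorchuk

namespace NcHaraSlade

open Set SimpleGraph Finset MeasureTheory Filter Topology Literature.Probability.Percolation Literature.Probability.LatticeModels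
  Literature.Barriers.CriticalPhenomena
open scoped ENNReal

variable {V : Type} [DecidableEq V] (G : SimpleGraph V) [G.LocallyFinite] [DecidableRel G.Adj]

/-! ## §1 Integration over the parameter -/

omit [DecidableRel G.Adj] in
/-- **On a CONNECTED locally finite graph `{v ↔ x} = ⋃_n {v ↔ x in B(v,n)}`** as sets: a (finite) open path visits finitely many vertices, each within finite graph
distance of `v`. [folklore] -/
theorem openConn_eq_iUnion_openConnIn_ball (hconn : G.Connected) (v x : V) :
    (openConn v x : Set (BondConfig V)) = ⋃ n : ℕ, (openConnIn (↑(DCTQ.ball G v n) : Set V) v x : Set (BondConfig V)) := by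
  refine Set.Subset.antisymm (fun ω hω => ?_) (Set.iUnion_subset fun n => fun ω hω => openConnIn_subset_openConn _ v x hω)
  have hpath : PathIn (openGraph ω) Set.univ v x := DCT16.pathIn_univ_of_reachable hω
  have key : ∃ n : ℕ, PathIn (openGraph ω) (↑(DCTQ.ball G v n) : Set V) v x := by
    refine DCT16.pathIn_induction (fun z => ∃ n : ℕ, PathIn (openGraph ω) (↑(DCTQ.ball G v n) : Set V) v z) hpath
      ⟨0, PathIn.refl (Finset.mem_coe.2 (DCTQ.mem_ball_self v 0))⟩ ?_
    rintro a b - - ⟨n, hn⟩ hab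
    obtain ⟨m, hm⟩ := DCTQ.exists_subset_ball hconn v {b}
    refine ⟨max n m, (hn.mono (Finset.coe_subset.2 (DCTQ.ball_mono v (le_max_left n m)))).tail hab ?_⟩
    exact Finset.mem_coe.2 (DCTQ.ball_mono v (le_max_right n m) (hm (Finset.mem_singleton_self b)))
  obtain ⟨n, hn⟩ := key
  exact Set.mem_iUnion.2 ⟨n, DCT16.mem_openConnIn_of_pathIn hn⟩

/-- **`∫_{[p,q]} Σ_x Σ_e P_s(e pivotal for {ρ↔x}) ds ≤ χ_q − χ_p`** for `0 < p ≤ q < p_c(ρ)` on a connected vertex-transitive graph: every finite part of the double sum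
integrates to at most `Σ_{x∈X}(τ_q(ρ,x) − τ_p(ρ,x))` by (a) `integral_sum_real_pivotal_le_conn_sub` (through `openConn_eq_iUnion_openConnIn_ball`), and the `tsum` of
non-negative measurable functions commutes with the integral. [cite: Hutchcroft2022Triangle, §2 (Russo's formula for χ = Σ_v P(o ↔ v), display (2.1))] -/
theorem lintegral_pivotalSum_le (htr : IsGraphTransitive G) (hconn : G.Connected) {p q : unitInterval} {ρ : V} (hp0 : 0 < (p : ℝ)) (hpq : p ≤ q)
    (hq : (q : ℝ) < criticalProb G ρ) :
    ∫⁻ s in Set.Icc (p : ℝ) q, pivotalSum G (prm s) ρ ≤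
      ENNReal.ofReal ((∑' x : V, conn G q ρ x) - ∑' x : V, conn G p ρ x) := by
  classical
  haveI : Countable V := countable_of_connected_of_locallyFinite G hconn ρ
  have hq1 : (q : ℝ) < 1 := hq.trans_le (criticalProb_mem_Icc _ _).2
  have hpq' : (p : ℝ) ≤ q := hpq
  have hprm : ∀ x : unitInterval, prm (x : ℝ) = x := fun x =>
    Subtype.ext (congrArg Subtype.val (Set.projIcc_of_mem zero_le_one ⟨x.2.1, x.2.2⟩))
  -- the pivotality probability, through the union of ball events
  set piv : V → Sym2 V → ℝ → ℝ := fun x e s => (bondPercolation G (prm s)).real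
    {ω | IsPivotal (⋃ n : ℕ, (openConnIn (↑(DCTQ.ball G ρ n) : Set V) ρ x : Set (BondConfig V))) e ω} with hpiv
  have hpivm : ∀ x e, Measurable (piv x e) := fun x e => measurable_real_pivotal_iUnion G ρ x e
  have hpiv0 : ∀ x e s, 0 ≤ piv x e s := fun _ _ _ => measureReal_nonneg
  have hpiv1 : ∀ x e s, piv x e s ≤ 1 := fun _ _ _ => measureReal_le_one
  -- the summands as functions of `s`
  set F : V × Sym2 V → ℝ → ℝ≥0∞ := fun xe s => if xe.2 ∈ G.edgeSet then ENNReal.ofReal (piv xe.1 xe.2 s) else 0 with hF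
  have hFm : ∀ xe, Measurable (F xe) := by
    intro xe
    by_cases he : xe.2 ∈ G.edgeSet
    · simp only [hF, he, if_true]
      exact (hpivm xe.1 xe.2).ennreal_ofReal
    · simp only [hF, he, if_false]
      exact measurable_const
  have hPS : ∀ s : ℝ, pivotalSum G (prm s) ρ = ∑' xe : V × Sym2 V, F xe s := by
    intro s
    rw [pivotalSum, ENNReal.tsum_prod']
    refine tsum_congr fun x => tsum_congr fun e => ?_
    simp only [hF]
    split_ifs
    · simp only [hpiv]
      rw [ofReal_measureReal (measure_ne_top _ _), openConn_eq_iUnion_openConnIn_ball G hconn ρ x]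
    · rfl
  simp_rw [hPS]
  rw [lintegral_tsum fun xe => (hFm xe).aemeasurable, ENNReal.tsum_eq_iSup_sum]
  refine iSup_le fun T => ?_
  -- a finite part `T`
  set X : Finset V := T.image Prod.fst with hX
  set E : Finset (Sym2 V) := (T.image Prod.snd).filter (· ∈ G.edgeSet) with hE
  have hEsub : (↑E : Set (Sym2 V)) ⊆ G.edgeSet := by
    intro e he
    simp only [hE, Finset.coe_filter, Set.mem_setOf_eq] at he
    exact he.2
  have hptw : ∀ s, ∑ xe ∈ T, F xe s ≤ ∑ x ∈ X, ENNReal.ofReal (∑ e ∈ E, piv x e s) := by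
    intro s
    calc ∑ xe ∈ T, F xe s ≤ ∑ xe ∈ X ×ˢ T.image Prod.snd, F xe s :=
          Finset.sum_le_sum_of_subset_of_nonneg (fun xe hxe => Finset.mem_product.2
            ⟨Finset.mem_image_of_mem _ hxe, Finset.mem_image_of_mem _ hxe⟩) fun _ _ _ => zero_le
      _ = ∑ x ∈ X, ∑ e ∈ T.image Prod.snd, F (x, e) s := Finset.sum_product _ _ _
      _ = ∑ x ∈ X, ENNReal.ofReal (∑ e ∈ E, piv x e s) := by
          refine Finset.sum_congr rfl fun x _ => ?_
          rw [ENNReal.ofReal_sum_of_nonneg (fun e _ => hpiv0 x e s), hE, Finset.sum_filter]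
  calc ∑ xe ∈ T, ∫⁻ s in Set.Icc (p : ℝ) q, F xe s
      = ∫⁻ s in Set.Icc (p : ℝ) q, ∑ xe ∈ T, F xe s := (lintegral_finsetSum _ fun xe _ => hFm xe).symm
    _ ≤ ∫⁻ s in Set.Icc (p : ℝ) q, ∑ x ∈ X, ENNReal.ofReal (∑ e ∈ E, piv x e s) := lintegral_mono fun s => hptw s
    _ = ∑ x ∈ X, ∫⁻ s in Set.Icc (p : ℝ) q, ENNReal.ofReal (∑ e ∈ E, piv x e s) := by
        refine lintegral_finsetSum _ fun x _ => ?_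
        exact (Finset.measurable_sum _ fun e _ => hpivm x e).ennreal_ofReal
    _ ≤ ∑ x ∈ X, ENNReal.ofReal (conn G q ρ x - conn G p ρ x) := by
        refine Finset.sum_le_sum fun x _ => ?_
        set g : ℝ → ℝ := fun s => ∑ e ∈ E, piv x e s with hg
        have hg0 : ∀ s, 0 ≤ g s := fun s => Finset.sum_nonneg fun e _ => hpiv0 x e s
        have hgle : ∀ s, g s ≤ E.card := fun s => by
          calc g s ≤ ∑ _e ∈ E, (1 : ℝ) := Finset.sum_le_sum fun e _ => hpiv1 x e s
            _ = E.card := by simp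
        have hgm : Measurable g := Finset.measurable_sum _ fun e _ => hpivm x e
        have hgi : Integrable g (volume.restrict (Set.Icc (p : ℝ) q)) := by
          refine (integrable_const (E.card : ℝ)).mono' hgm.aestronglyMeasurable (ae_of_all _ fun s => ?_)
          rw [Real.norm_eq_abs, abs_of_nonneg (hg0 s)]; exact hgle s
        rw [← ofReal_integral_eq_lintegral_ofReal hgi (ae_of_all _ hg0)]
        refine ENNReal.ofReal_le_ofReal ?_
        have h := integral_sum_real_pivotal_le_conn_sub G ρ x hEsub hp0 hpq' hq1
        rw [intervalIntegral.integral_of_le hpq', ← integral_Icc_eq_integral_Ioc, hprm p, hprm q] at h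
        exact h
    _ = ENNReal.ofReal (∑ x ∈ X, (conn G q ρ x - conn G p ρ x)) :=
        (ENNReal.ofReal_sum_of_nonneg fun x _ => sub_nonneg.2 (conn_mono G hpq ρ x)).symm
    _ ≤ ENNReal.ofReal ((∑' x : V, conn G q ρ x) - ∑' x : V, conn G p ρ x) := by
        refine ENNReal.ofReal_le_ofReal ?_
        have hsq := summable_conn_left G htr hconn hq ρ
        have hsp := summable_conn_left G htr hconn (lt_of_le_of_lt hpq' hq) ρ
        rw [← hsq.tsum_sub hsp]
        exact (hsq.sub hsp).sum_le_tsum X fun x _ => sub_nonneg.2 (conn_mono G hpq ρ x)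

/-! ## §2 Prop. 1.6, integrated -/

/-- **Hutchcroft's Prop. 1.6 on a connected vertex-transitive graph with degrees `≤ D` (`D ≥ 1`), integrated form**: for `0 < p ≤ q < p_c(ρ)`, `∇_q(ρ) ≤ Δ ≤ χ_p`
and `2A₀_q(ρ) + B₀_q(ρ) ≤ M`, `(q − p)(χ_p − Δ)² ≤ D q² M (χ_q − χ_p)` — integrate `pivotalSum_ge` (with the monotonicity of `χ`, `∇`, `A₀`, `B₀` in the parameter)
over `[p, q]` and compare with `lintegral_pivotalSum_le`.  Printed: `dχ/dβ ≥ χ_β(χ_β − ∇_β)/(β²(2A_β + B_β))` for every connected transitive weighted graph with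
`Σ_{e∋o} J_e = 1`; here `P(e open) = p`, Russo in `p`, and `Σ_{e∋v} 1 ≤ D` in place of the normalisation (`D = 0` would force a one-vertex graph, where `p_c = 1` by
convention and the inequality degenerates; excluded). [cite: Hutchcroft2022Triangle, Prop. 1.6] -/
theorem prop16_transitive (htr : IsGraphTransitive G) (hconn : G.Connected) {D : ℕ} (hD : 0 < D) (hdeg : ∀ a : V, G.degree a ≤ D) {ρ : V} {p q : unitInterval}
    (hp0 : 0 < (p : ℝ)) (hpq : p ≤ q) (hq : (q : ℝ) < criticalProb G ρ) {Δ M : ℝ} (hΔ : triangle G ρ q ≤ ENNReal.ofReal Δ)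
    (hM : 2 * diagA₀ G ρ q + diagB₀ G ρ q ≤ ENNReal.ofReal M) (hΔχ : Δ ≤ ∑' x : V, conn G p ρ x) :
    ((q : ℝ) - p) * ((∑' x : V, conn G p ρ x) - Δ) ^ 2 ≤ D * (q : ℝ) ^ 2 * M * ((∑' x : V, conn G q ρ x) - ∑' x : V, conn G p ρ x) := by
  haveI : Countable V := countable_of_connected_of_locallyFinite G hconn ρ
  set pc := criticalProb G ρ with hpc
  have hpq' : (p : ℝ) ≤ q := hpq
  have hp_lt : (p : ℝ) < pc := lt_of_le_of_lt hpq' hq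
  have hq0 : 0 < (q : ℝ) := hp0.trans_le hpq'
  have hDR : (0 : ℝ) < D := by exact_mod_cast hD
  have hprmval : ∀ {x : ℝ}, 0 ≤ x → x ≤ 1 → ((prm x : unitInterval) : ℝ) = x := fun h0 h1 =>
    congrArg Subtype.val (Set.projIcc_of_mem zero_le_one ⟨h0, h1⟩)
  -- `M ≥ 1`
  have hM1 : 1 ≤ M := by
    have h := ((one_le_diagB₀ G ρ q).trans le_add_self).trans hM
    by_contra hlt; push Not at hlt
    have : ENNReal.ofReal M < 1 := by
      rw [← ENNReal.ofReal_one]; exact (ENNReal.ofReal_lt_ofReal_iff zero_lt_one).2 hlt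
    exact absurd h (not_le.2 this)
  have hM0 : 0 < M := by linarith
  set c : ℝ := ((∑' x : V, conn G p ρ x) - Δ) ^ 2 / (D * (q : ℝ) ^ 2 * M) with hc
  have hc0 : 0 ≤ c := by positivity
  -- pointwise lower bound on `[p, q]`
  have hpt : ∀ s ∈ Set.Icc (p : ℝ) q, ENNReal.ofReal c ≤ pivotalSum G (prm s) ρ := by
    intro s hs
    have hs0 : 0 < s := hp0.trans_le hs.1
    have hs1 : s ≤ 1 := hs.2.trans q.2.2
    have hsval : ((prm s : unitInterval) : ℝ) = s := hprmval hs0.le hs1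
    have hs_lt : ((prm s : unitInterval) : ℝ) < pc := by rw [hsval]; exact hs.2.trans_lt hq
    have hps : p ≤ prm s := show (p : ℝ) ≤ ((prm s : unitInterval) : ℝ) by rw [hsval]; exact hs.1
    have hsq : prm s ≤ q := show ((prm s : unitInterval) : ℝ) ≤ (q : ℝ) by rw [hsval]; exact hs.2
    have hΔs : triangle G ρ (prm s) ≤ ENNReal.ofReal Δ := (triangle_mono G hsq ρ).trans hΔ
    have hMs : 2 * diagA₀ G ρ (prm s) + diagB₀ G ρ (prm s) ≤ ENNReal.ofReal M :=
      le_trans (add_le_add (mul_le_mul_of_nonneg_left (diagA₀_mono G hsq ρ) zero_le) (diagB₀_mono G hsq ρ)) hM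
    have hχs : ∑' x : V, conn G p ρ x ≤ ∑' x : V, conn G (prm s) ρ x := tsum_conn_mono G htr hconn hps hs_lt
    have hΔχs : Δ ≤ ∑' x : V, conn G (prm s) ρ x := hΔχ.trans hχs
    have h := pivotalSum_ge G htr hconn (by rw [hsval]; exact hs0) hs_lt hdeg hΔs hMs hΔχs
    refine le_trans (ENNReal.ofReal_le_ofReal ?_) h
    rw [hsval, hc]
    have hnum : ((∑' x : V, conn G p ρ x) - Δ) ^ 2 ≤ ((∑' x : V, conn G (prm s) ρ x) - Δ) ^ 2 :=
      pow_le_pow_left₀ (by linarith) (by linarith) 2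
    have hden : D * s ^ 2 * M ≤ D * (q : ℝ) ^ 2 * M := by
      have : s ^ 2 ≤ (q : ℝ) ^ 2 := pow_le_pow_left₀ hs0.le hs.2 2
      exact mul_le_mul_of_nonneg_right (mul_le_mul_of_nonneg_left this hDR.le) hM0.le
    have hden0 : 0 < D * s ^ 2 * M := by positivity
    calc ((∑' x : V, conn G p ρ x) - Δ) ^ 2 / (D * (q : ℝ) ^ 2 * M) ≤ ((∑' x : V, conn G p ρ x) - Δ) ^ 2 / (D * s ^ 2 * M) :=
          div_le_div_of_nonneg_left (sq_nonneg _) hden0 hden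
      _ ≤ ((∑' x : V, conn G (prm s) ρ x) - Δ) ^ 2 / (D * s ^ 2 * M) := div_le_div_of_nonneg_right hnum hden0.le
  -- integrate
  have hint : ENNReal.ofReal (c * ((q : ℝ) - p)) ≤ ENNReal.ofReal ((∑' x : V, conn G q ρ x) - ∑' x : V, conn G p ρ x) := by
    calc ENNReal.ofReal (c * ((q : ℝ) - p)) = ∫⁻ _ in Set.Icc (p : ℝ) q, ENNReal.ofReal c := by
          rw [setLIntegral_const, Real.volume_Icc, ENNReal.ofReal_mul hc0]
      _ ≤ ∫⁻ s in Set.Icc (p : ℝ) q, pivotalSum G (prm s) ρ := setLIntegral_mono' measurableSet_Icc fun s hs => hpt s hs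
      _ ≤ _ := lintegral_pivotalSum_le G htr hconn hp0 hpq hq
  have hχmono : ∑' x : V, conn G p ρ x ≤ ∑' x : V, conn G q ρ x := tsum_conn_mono G htr hconn hpq hq
  have hreal : c * ((q : ℝ) - p) ≤ (∑' x : V, conn G q ρ x) - ∑' x : V, conn G p ρ x :=
    (ENNReal.ofReal_le_ofReal_iff (by linarith)).1 hint
  -- unfold `c`
  have hden0 : 0 < D * (q : ℝ) ^ 2 * M := by positivity
  have : ((q : ℝ) - p) * ((∑' x : V, conn G p ρ x) - Δ) ^ 2 = c * ((q : ℝ) - p) * (D * (q : ℝ) ^ 2 * M) := by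
    rw [hc]; field_simp
  rw [this]
  calc c * ((q : ℝ) - p) * (D * (q : ℝ) ^ 2 * M) ≤ ((∑' x : V, conn G q ρ x) - ∑' x : V, conn G p ρ x) * (D * (q : ℝ) ^ 2 * M) :=
        mul_le_mul_of_nonneg_right hreal hden0.le
    _ = D * (q : ℝ) ^ 2 * M * ((∑' x : V, conn G q ρ x) - ∑' x : V, conn G p ρ x) := by ring

end NcHaraSlade

end Grigorchuk

end Summit.CriticalPhenomena.PercolationContinuityZ3.Theorems.Transplant

end
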